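import Summits.CriticalPhenomena.PercolationContinuityZ3.Theorems.PercNearOneGluingNoHeavyQuantFarRelayRowStar
import HarnessLib

/-!
# QUANT lane R8: FAR (`Quant.FarRelayRow`) PROVED for block-stars — an observer gated to disjoint glued blobs

builds on p205010 (kernel theorem, internal audit signed; external expert review pending)

Support file (`--supports stmt-CriticalPhenomena-4575`), QUANT lane lead (gen 5); memo
`run/shared/lean/prim/quant/prim-quant-lead-g5/LEAD-NOTES-G5.md` N12–N13.

`Quant.farRelayRow_star` (`…QuantFarRelayRowStar.lean`) proves the body of `Quant.FarRelayRow` for weights supported on the star at `o`.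
Here the same is proved for BLOCK-STARS, the family on which FAR is TIGHT in every census (LEAD-NOTES-G4 N11 (5)–(6): `o` glued to `j`
relays plus one gated glued blob of `j + 1` relays gives equality): the vertices other than `o` are grouped into blobs by a map `β`
(`β x` = the gateway of the blob of `x`, `β x ≠ o`), every vertex is glued to its gateway (`w s(β x, x) = 1`), pairs between
different blobs and pairs from `o` to non-gateways carry weight `0`; the weights of the gates `s(o, β x)` and of the remaining intra-blob pairs
are ARBITRARY.  Then (`farRelayRow_blockStar`) `2j < Σ_{a∈A} P(o ↔ a)` and `P(o ↮ a) ≤ t` (`a ∈ A`) imply `P(#{a ∈ A | o ↔ a} ≤ j) ≤ t`.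
On a configuration of positive probability `o ↔ a` iff the gate `s(o, β a)` is open (`mem_openConn_iff_of_blockStar`: an open walk from `o`
never changes blob except through `o`, and enters a blob only at its gateway — induction on the walk), so the relay count is
`[o ∈ A] + Σ_{e open} #{a ∈ A ∖ o | s(o, β a) = e}` and the claim is `IndepBlob.far_indepBlob_support` (relevant gates = gates of blobs
meeting `A`).  `β = id` recovers `farRelayRow_star`.  No new definitions; standard axioms.
-/

noncomputable section

namespace Summit.CriticalPhenomena.PercolationContinuityZ3.Theorems

namespace Quant

open Finset MeasureTheory
open Literature.Probability.LatticeModels (prodBernoulli)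
open Literature.Probability.Percolation
open scoped Classical

variable {n : ℕ}

/-- Invariant of an open walk in a block-star configuration: if the configuration `s` joins `o` only to gateways (`s(o,x) ∈ s → β x = x`)
and has no pair between different blobs, then along any open walk the property '`v = o` or the gate `s(o, β v)` is open' propagates.
[this work] -/
theorem openWalk_blockStar_invariant (o : Fin n) (β : Fin n → Fin n) (s : Finset (Sym2 (Fin n)))
    (h1 : ∀ x, x ≠ o → s(o, x) ∈ s → β x = x)
    (h2 : ∀ x y, x ≠ o → y ≠ o → x ≠ y → s(x, y) ∈ s → β x = β y) :
    ∀ (u v : Fin n) (q : (openGraph (↑s : BondConfig (Fin n))).Walk u v),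
      (u = o ∨ s(o, β u) ∈ s) → (v = o ∨ s(o, β v) ∈ s) := by
  intro u v q
  induction q with
  | nil => exact id
  | cons hadj q' ih =>
    rename_i u' x v'
    intro hu
    apply ih
    rw [openGraph_adj] at hadj
    have hmem : s(u', x) ∈ s := by exact_mod_cast hadj.1
    by_cases hxo : x = o
    · exact Or.inl hxo
    · right
      rcases hu with hu | hu
      · -- the step leaves `o`: it enters a blob at its gateway
        rw [hu] at hmem
        rw [h1 x hxo hmem]
        exact hmem
      · -- the step stays inside a blob
        by_cases huo : u' = o
        · rw [huo] at hmem
          rw [h1 x hxo hmem]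
          exact hmem
        · rw [← h2 u' x huo hxo hadj.2 hmem]
          exact hu

/-- On a block-star configuration of positive probability (gates only to gateways, no pair between blobs, every vertex glued to its
gateway), a vertex `a ≠ o` is joined to `o` iff the gate `s(o, β a)` of its blob is open. [this work] -/
theorem mem_openConn_iff_of_blockStar (o : Fin n) (β : Fin n → Fin n) (hβo : ∀ x, x ≠ o → β x ≠ o) (a : Fin n) (hao : a ≠ o)
    (s : Finset (Sym2 (Fin n)))
    (h1 : ∀ x, x ≠ o → s(o, x) ∈ s → β x = x)
    (h2 : ∀ x y, x ≠ o → y ≠ o → x ≠ y → s(x, y) ∈ s → β x = β y)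
    (h3 : ∀ x, x ≠ o → β x ≠ x → s(β x, x) ∈ s) :
    ((↑s : BondConfig (Fin n)) ∈ openConn o a) ↔ s(o, β a) ∈ s := by
  constructor
  · intro h
    have hr : (openGraph (↑s : BondConfig (Fin n))).Reachable o a := h
    obtain ⟨p⟩ := hr
    rcases openWalk_blockStar_invariant o β s h1 h2 o a p (Or.inl rfl) with h' | h'
    · exact absurd h' hao
    · exact h'
  · intro h
    have hgate : (openGraph (↑s : BondConfig (Fin n))).Adj o (β a) := by
      rw [openGraph_adj]
      exact ⟨by exact_mod_cast h, fun hob => hβo a hao hob.symm⟩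
    by_cases hβa : β a = a
    · rw [hβa] at hgate
      exact hgate.reachable
    · have hsp : (openGraph (↑s : BondConfig (Fin n))).Adj (β a) a := by
        rw [openGraph_adj]
        exact ⟨by exact_mod_cast h3 a hao hβa, hβa⟩
      exact hgate.reachable.trans hsp.reachable

/-- **FAR (`Quant.FarRelayRow`) holds for block-stars.**  Data: a gateway map `β` on the vertices (`β x ≠ o` for `x ≠ o`), weights
with `w s(β x, x) = 1` (every vertex glued to the gateway of its blob), `w s(x, y) = 0` between different blobs, `w s(o, x) = 0` unless `x` is
a gateway; all other weights (the gates `s(o, β x)`, further intra-blob pairs, loops) arbitrary.  Then for every `A`, `j`, `t`: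
`2j < Σ_{a∈A} P(o ↔ a)` and `P(o ↮ a) ≤ t` for all `a ∈ A` imply `P(#{a ∈ A | o ↔ a} ≤ j) ≤ t` — the body of `Quant.FarRelayRow`.
This is the family on which FAR is an EQUALITY in the census (`o` glued to `j` relays + one gated glued `(j+1)`-blob). [this work] -/
theorem farRelayRow_blockStar (n : ℕ) (w : Sym2 (Fin n) → unitInterval) (A : Finset (Fin n)) (o : Fin n) (j : ℕ) (t : ℝ)
    (β : Fin n → Fin n) (hβo : ∀ x, x ≠ o → β x ≠ o)
    (hglue : ∀ x, x ≠ o → β x ≠ x → w s(β x, x) = 1)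
    (hcross : ∀ x y, x ≠ o → y ≠ o → x ≠ y → β x ≠ β y → w s(x, y) = 0)
    (hgate : ∀ x, x ≠ o → β x ≠ x → w s(o, x) = 0)
    (hEN : (2 * j : ℝ) < ∑ a ∈ A, (prodBernoulli w).real (openConn o a))
    (ht : ∀ a ∈ A, (prodBernoulli w).real (openConn o a)ᶜ ≤ t) :
    (prodBernoulli w).real {ω : BondConfig (Fin n) | (A.filter fun a => ω ∈ openConn o a).card ≤ j} ≤ t := by
  set μ := prodBernoulli w with hμ
  set p : Sym2 (Fin n) → ℝ := fun e => ((w e : unitInterval) : ℝ) with hp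
  -- the product weight of a finset of pairs
  set W : Finset (Sym2 (Fin n)) → ℝ := fun s => ∏ e, (if e ∈ s then p e else 1 - p e) with hW
  have hp0 : ∀ e, 0 ≤ p e := fun e => (w e).2.1
  have hp1 : ∀ e, p e ≤ 1 := fun e => (w e).2.2
  have hmeas : ∀ S : Set (BondConfig (Fin n)), MeasurableSet S := fun S => (Set.toFinite S).measurableSet
  -- positive atoms contain no weight-0 pair and every weight-1 pair
  have hpos0 : ∀ s : Finset (Sym2 (Fin n)), W s ≠ 0 → ∀ e ∈ s, w e ≠ 0 := by
    intro s hWs e he hwe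
    apply hWs
    simp only [hW]
    refine Finset.prod_eq_zero (Finset.mem_univ e) ?_
    rw [if_pos he, hp]
    simp [hwe]
  have hpos1 : ∀ s : Finset (Sym2 (Fin n)), W s ≠ 0 → ∀ e, w e = 1 → e ∈ s := by
    intro s hWs e hwe
    by_contra he
    apply hWs
    simp only [hW]
    refine Finset.prod_eq_zero (Finset.mem_univ e) ?_
    rw [if_neg he, hp]
    simp [hwe]
  -- hence, on a positive atom, the structural hypotheses of `mem_openConn_iff_of_blockStar` hold
  have hS1 : ∀ s : Finset (Sym2 (Fin n)), W s ≠ 0 → ∀ x, x ≠ o → s(o, x) ∈ s → β x = x := by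
    intro s hWs x hxo hx
    by_contra hβx
    exact hpos0 s hWs _ hx (hgate x hxo hβx)
  have hS2 : ∀ s : Finset (Sym2 (Fin n)), W s ≠ 0 → ∀ x y, x ≠ o → y ≠ o → x ≠ y → s(x, y) ∈ s → β x = β y := by
    intro s hWs x y hxo hyo hxy hxy'
    by_contra hβ
    exact hpos0 s hWs _ hxy' (hcross x y hxo hyo hxy hβ)
  have hS3 : ∀ s : Finset (Sym2 (Fin n)), W s ≠ 0 → ∀ x, x ≠ o → β x ≠ x → s(β x, x) ∈ s := by
    intro s hWs x hxo hβx
    exact hpos1 s hWs _ (hglue x hxo hβx)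
  have hconn : ∀ s : Finset (Sym2 (Fin n)), W s ≠ 0 → ∀ a, a ≠ o →
      (((↑s : BondConfig (Fin n)) ∈ openConn o a) ↔ s(o, β a) ∈ s) := fun s hWs a hao =>
    mem_openConn_iff_of_blockStar o β hβo a hao s (hS1 s hWs) (hS2 s hWs) (hS3 s hWs)
  -- the relay weights on the pairs: `c e = #{a ∈ A \ o | s(o, β a) = e}`
  set c : Sym2 (Fin n) → ℝ := fun e => ∑ a ∈ A.erase o, (if s(o, β a) = e then (1 : ℝ) else 0) with hc
  have hc0 : ∀ e, 0 ≤ c e := fun e => Finset.sum_nonneg fun a _ => by split_ifs <;> norm_num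
  set δ : ℝ := if o ∈ A then 1 else 0 with hδ
  -- the relay count on a star configuration
  have hcount : ∀ s : Finset (Sym2 (Fin n)), W s ≠ 0 →
      ((A.filter fun a => (↑s : BondConfig (Fin n)) ∈ openConn o a).card : ℝ) = δ + ∑ e ∈ s, c e := by
    intro s hWs
    have hs := hconn s hWs
    -- split off `o`
    have hsplit : (A.filter fun a => (↑s : BondConfig (Fin n)) ∈ openConn o a) =
        (A.filter fun a => a = o) ∪ ((A.erase o).filter fun a => s(o, β a) ∈ s) := by
      ext a
      simp only [Finset.mem_filter, Finset.mem_union, Finset.mem_erase]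
      constructor
      · rintro ⟨haA, hconn'⟩
        by_cases hao : a = o
        · exact Or.inl ⟨haA, hao⟩
        · exact Or.inr ⟨⟨hao, haA⟩, (hs a hao).1 hconn'⟩
      · rintro (⟨haA, hao⟩ | ⟨⟨hao, haA⟩, he⟩)
        · refine ⟨haA, ?_⟩
          rw [hao]
          exact SimpleGraph.Reachable.refl o
        · exact ⟨haA, (hs a hao).2 he⟩
    have hdisj : Disjoint (A.filter fun a => a = o) ((A.erase o).filter fun a => s(o, β a) ∈ s) := by
      rw [Finset.disjoint_left]
      intro a ha ha'
      rw [Finset.mem_filter] at ha ha'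
      exact (Finset.mem_erase.1 ha'.1).1 ha.2
    rw [hsplit, Finset.card_union_of_disjoint hdisj, Nat.cast_add]
    congr 1
    · rw [hδ]
      split_ifs with hoA
      · have : (A.filter fun a => a = o) = {o} := by
          ext a
          simp only [Finset.mem_filter, Finset.mem_singleton]
          exact ⟨fun h => h.2, fun h => ⟨h ▸ hoA, h⟩⟩
        rw [this, Finset.card_singleton, Nat.cast_one]
      · have : (A.filter fun a => a = o) = ∅ := by
          ext a
          simp only [Finset.mem_filter, Finset.notMem_empty, iff_false, not_and]
          intro haA hao
          exact hoA (hao ▸ haA)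
        rw [this, Finset.card_empty, Nat.cast_zero]
    · rw [Finset.card_filter, Nat.cast_sum, hc, Finset.sum_comm]
      refine Finset.sum_congr rfl fun a _ => ?_
      rw [Finset.sum_ite_eq]
      push_cast
      rfl
  -- marginals: `P(o ↔ a) = w(s(o,a))` for `a ≠ o`, and `= 1` for `a = o`
  have hmarg : ∀ a : Fin n, a ≠ o → μ.real (openConn o a) = p s(o, β a) := by
    intro a hao
    rw [hμ, IndepBlob.prodBernoulli_real_eq_sum_finset, Finset.sum_filter]
    have e1 : ∀ s : Finset (Sym2 (Fin n)),
        (if ((↑s : BondConfig (Fin n)) ∈ openConn o a) then W s else 0) = W s * (if s(o, β a) ∈ s then (1 : ℝ) else 0) := by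
      intro s
      by_cases hWs : W s = 0
      · rw [hWs]; simp
      · rw [hconn s hWs a hao]
        split_ifs <;> simp
    rw [Finset.sum_congr rfl fun s _ => e1 s]
    exact IndepBlob.sum_bernoulliWeight_mul_indicator p s(o, β a)
  have hself : μ.real (openConn o o) = 1 := by
    have : (openConn o o : Set (BondConfig (Fin n))) = Set.univ :=
      Set.eq_univ_of_forall fun ω => SimpleGraph.Reachable.refl o
    rw [this, probReal_univ]
  -- the mean: `EN = δ + Σ_e c e p e`
  have hmean : ∑ a ∈ A, μ.real (openConn o a) = δ + ∑ e, c e * p e := by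
    have h2 : ∑ e, c e * p e = ∑ a ∈ A.erase o, p s(o, β a) := by
      simp only [hc, Finset.sum_mul]
      rw [Finset.sum_comm]
      refine Finset.sum_congr rfl fun a _ => ?_
      simp_rw [ite_mul, one_mul, zero_mul]
      rw [Finset.sum_ite_eq]
      simp
    rw [h2, hδ]
    split_ifs with hoA
    · rw [← Finset.add_sum_erase A _ hoA, hself]
      congr 1
      exact Finset.sum_congr rfl fun a ha => hmarg a (Finset.mem_erase.1 ha).1
    · rw [zero_add]
      have hAe : A.erase o = A := Finset.erase_eq_of_notMem hoA
      rw [hAe]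
      exact Finset.sum_congr rfl fun a ha => hmarg a (fun hao => hoA (hao ▸ ha))
  -- the event as a filtered sum of product weights
  have hevent : μ.real {ω : BondConfig (Fin n) | (A.filter fun a => ω ∈ openConn o a).card ≤ j} =
      ∑ s ∈ (Finset.univ : Finset (Finset (Sym2 (Fin n)))).filter (fun s => ∑ e ∈ s, c e ≤ (j : ℝ) - δ), W s := by
    rw [hμ, IndepBlob.prodBernoulli_real_eq_sum_finset, Finset.sum_filter, Finset.sum_filter]
    refine Finset.sum_congr rfl fun s _ => ?_
    by_cases hWs : W s = 0
    · have hraw : (∏ k, if k ∈ s then ((w k : unitInterval) : ℝ) else 1 - ((w k : unitInterval) : ℝ)) = 0 := hWs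
      rw [hraw]
      simp [hWs]
    · have hcs := hcount s hWs
      have hiff : ((↑s : BondConfig (Fin n)) ∈ {ω : BondConfig (Fin n) | (A.filter fun a => ω ∈ openConn o a).card ≤ j}) ↔
          ∑ e ∈ s, c e ≤ (j : ℝ) - δ := by
        rw [Set.mem_setOf_eq]
        constructor
        · intro h
          have : ((A.filter fun a => (↑s : BondConfig (Fin n)) ∈ openConn o a).card : ℝ) ≤ j := by exact_mod_cast h
          linarith
        · intro h
          have : ((A.filter fun a => (↑s : BondConfig (Fin n)) ∈ openConn o a).card : ℝ) ≤ j := by linarith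
          exact_mod_cast this
      simp only [hiff]
      split_ifs <;> rfl
  -- degenerate case: no relay other than `o`
  rcases (A.erase o).eq_empty_or_nonempty with hAe | hAne
  · -- then `EN = δ ≤ 1`, so `j = 0` and `o ∈ A`; the event is null
    have hc0' : ∀ e, c e = 0 := fun e => by simp only [hc, hAe, Finset.sum_empty]
    have hENle : ∑ a ∈ A, μ.real (openConn o a) ≤ 1 := by
      rw [hmean]
      simp only [hc0', zero_mul, Finset.sum_const_zero, add_zero, hδ]
      split_ifs <;> norm_num
    have hj0 : j = 0 := by
      by_contra hj
      have : (1 : ℝ) ≤ j := by exact_mod_cast Nat.one_le_iff_ne_zero.2 hj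
      linarith
    have hoA : o ∈ A := by
      by_contra hoA
      have : ∑ a ∈ A, μ.real (openConn o a) = 0 := by
        rw [hmean]; simp [hc0', hδ, hoA]
      rw [this] at hEN
      have : (0 : ℝ) ≤ 2 * j := by positivity
      linarith
    have ht0 : 0 ≤ t := by
      have := ht o hoA
      rw [probReal_compl_eq_one_sub (hmeas _), hself] at this
      linarith
    rw [hevent]
    refine le_trans (le_of_eq ?_) ht0
    refine Finset.sum_eq_zero fun s hs => ?_
    rw [Finset.mem_filter] at hs
    have h1 : ∑ e ∈ s, c e = 0 := Finset.sum_eq_zero fun e _ => hc0' e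
    have : (j : ℝ) - δ = -1 := by rw [hj0, hδ, if_pos hoA]; norm_num
    rw [h1, this] at hs
    linarith [hs.2]
  -- main case: pick the least reliable relay `a⋆ ≠ o`
  obtain ⟨astar, hastar, hmin⟩ := Finset.exists_min_image (A.erase o) (fun a => p s(o, β a)) hAne
  have hastarA : astar ∈ A := (Finset.mem_erase.1 hastar).2
  have hastaro : astar ≠ o := (Finset.mem_erase.1 hastar).1
  set y : Sym2 (Fin n) := s(o, β astar) with hy
  have hcy : c y ≠ 0 := by
    have : (1 : ℝ) ≤ c y := by
      simp only [hc]
      rw [← Finset.sum_erase_add _ _ hastar]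
      simp only [hy, if_true]
      have : 0 ≤ ∑ a ∈ (A.erase o).erase astar, (if s(o, β a) = s(o, β astar) then (1 : ℝ) else 0) :=
        Finset.sum_nonneg fun a _ => by split_ifs <;> norm_num
      linarith
    linarith
  have hymin : ∀ e, c e ≠ 0 → p y ≤ p e := by
    intro e hce
    -- some relay `a ∈ A \ o` has `s(o,a) = e`
    by_contra hlt
    apply hce
    simp only [hc]
    refine Finset.sum_eq_zero fun a ha => ?_
    split_ifs with hae
    · exact absurd (hae ▸ hmin a ha) hlt
    · rfl
  -- the threshold
  have hj' : 2 * ((j : ℝ) - δ) < ∑ e, c e * p e := by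
    have := hEN
    rw [hmean] at this
    rw [hδ] at this ⊢
    split_ifs with hoA <;> simp only [hoA, if_true, if_false] at this <;> linarith
  have key := IndepBlob.far_indepBlob_support p c hp0 hp1 hc0 y hcy hymin ((j : ℝ) - δ) hj'
  -- `1 - p y = P(o ↮ a⋆) ≤ t`
  have hcompl : μ.real (openConn o astar)ᶜ = 1 - p y := by
    rw [probReal_compl_eq_one_sub (hmeas _), hmarg astar hastaro]
  rw [hevent]
  calc ∑ s ∈ (Finset.univ : Finset (Finset (Sym2 (Fin n)))).filter (fun s => ∑ e ∈ s, c e ≤ (j : ℝ) - δ), W s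
      ≤ 1 - p y := key
    _ = μ.real (openConn o astar)ᶜ := hcompl.symm
    _ ≤ t := ht astar hastarA

end Quant

end Summit.CriticalPhenomena.PercolationContinuityZ3.Theorems
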